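import Mathlib
import Literature.NumberTheory.Sieve.FriedlanderIwaniecPrimesThresholdSeparation
import Summits.Parity.GeneralizedHardyLittlewood.Theorems.FordMaynardSieveConst01651SieveConst01651TypeIICoeffs

/-!
# Route `FordMaynardSieveConst01651`, target `SieveConst01651` (stmt-Parity-19185), line `sieve_decomposition`:
# helpers towards `stub_typeIIRegion` — applying a (separated) bilinear bound with tuple coefficients

Closes the loop `(II) ⇒ BilinBoundedBy (τ^{B'}-weighted kernel)` (`bilinBoundedBy_of_typeII`, …TypeIIBilin)
`⇒ separation transformers` (`.threshold`, `.cutoff`, `bilin_threshold_nat`, …; …BilinTools)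
`⇒ evaluation at the coefficients Y₁, Y₂ of Ford–Maynard's (eq:sieve-final)` (this file): if every bilinear form
in the kernel `τ(m)^{B'} τ(n)^{B'} K(m, n)` over `W × Z` with `1`-bounded coefficients is `≤ X`, then for `1`-bounded
`υ₁, …, υ_k`, `υ'₁, …, υ'_l` with `k − 1, l − 1 ≤ B'`, `0 ≤ B'`,
`|∑_{m ∈ W} ∑_{n ∈ Z} Y(m) Y'(n) K(m, n)| ≤ X`, `Y(m) = ∑_{m = m₁⋯m_k} ∏ υᵢ(mᵢ)`, `Y'(n) = ∑_{n = n₁⋯n_l} ∏ υ'ⱼ(nⱼ)`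
(`|Y| ≤ τ_k ≤ τ^{k−1} ≤ τ^{B'}`, Lemma 7.7 / `norm_tupleCoeff_le_rpow`).
[Ford–Maynard, arXiv:2407.14368v1, proof of Proposition 7.22, last paragraph.]
Def-free. Nothing here proves anything about the Parity summit.
-/

open Finset Literature.NumberTheory.Sieve.FriedlanderIwaniecPrimes

namespace Summit.Parity.GeneralizedHardyLittlewood.FordMaynardSieveConst01651SieveConst01651

/-- **A `τ^{B'}`-weighted bilinear bound applied to tuple coefficients** (the last step of the proof of
Proposition 7.22, for an arbitrary — e.g. already separated — kernel `K`).
[cite: FordMaynard2024PrimeSieves, proof of Proposition 7.22 (last paragraph) and Lemma 7.7] -/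
theorem bilin_apply_tupleCoeff {K : ℕ → ℕ → ℂ} {W Z : Finset ℕ} {X B' : ℝ}
    (h : BilinBoundedBy (fun m n => (((m.divisors.card : ℝ) ^ B' : ℝ) : ℂ) *
      (((n.divisors.card : ℝ) ^ B' : ℝ) : ℂ) * K m n) W Z X)
    (hB'0 : 0 ≤ B') {k l : ℕ} (υ : Fin k → ℕ → ℂ) (hυ : ∀ i a, ‖υ i a‖ ≤ 1) (υ' : Fin l → ℕ → ℂ)
    (hυ' : ∀ j a, ‖υ' j a‖ ≤ 1) (hk : (k : ℝ) - 1 ≤ B') (hl : (l : ℝ) - 1 ≤ B') :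
    ‖∑ m ∈ W, ∑ n ∈ Z, (∑ t ∈ Nat.finMulAntidiag k m, ∏ i, υ i (t i)) *
        (∑ t ∈ Nat.finMulAntidiag l n, ∏ j, υ' j (t j)) * K m n‖ ≤ X := by
  -- normalised coefficients `a = Y / τ^{B'}`, `b = Y' / τ^{B'}` (and `0` at `0`, where `Y = 0` anyway)
  set Y : ℕ → ℂ := fun m => ∑ t ∈ Nat.finMulAntidiag k m, ∏ i, υ i (t i) with hY
  set Y' : ℕ → ℂ := fun n => ∑ t ∈ Nat.finMulAntidiag l n, ∏ j, υ' j (t j) with hY'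
  set a : ℕ → ℂ := fun m => if m = 0 then 0 else Y m / (((m.divisors.card : ℝ) ^ B' : ℝ) : ℂ) with ha
  set b : ℕ → ℂ := fun n => if n = 0 then 0 else Y' n / (((n.divisors.card : ℝ) ^ B' : ℝ) : ℂ) with hb
  have hτpos : ∀ m : ℕ, m ≠ 0 → (0 : ℝ) < (m.divisors.card : ℝ) ^ B' := fun m hm =>
    Real.rpow_pos_of_pos (by exact_mod_cast Finset.card_pos.mpr ⟨1, Nat.one_mem_divisors.mpr hm⟩) _
  have hnorm : ∀ (c : ℕ → ℂ) (hc : ∀ m, ‖c m‖ ≤ (m.divisors.card : ℝ) ^ B') (m : ℕ),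
      ‖(if m = 0 then 0 else c m / (((m.divisors.card : ℝ) ^ B' : ℝ) : ℂ))‖ ≤ 1 := by
    intro c hc m
    split_ifs with hm
    · simp
    · rw [norm_div, Complex.norm_real, Real.norm_of_nonneg (hτpos m hm).le, div_le_one (hτpos m hm)]
      exact hc m
  have haY : ∀ m, ‖a m‖ ≤ 1 := hnorm Y (fun m => norm_tupleCoeff_le_rpow υ hυ hB'0 hk m)
  have hbY : ∀ n, ‖b n‖ ≤ 1 := hnorm Y' (fun n => norm_tupleCoeff_le_rpow υ' hυ' hB'0 hl n)
  have hmain := h a b haY hbY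
  refine le_of_eq_of_le ?_ hmain
  congr 1
  refine Finset.sum_congr rfl fun m _ => Finset.sum_congr rfl fun n _ => ?_
  -- `a m * b n * (τ^B' τ^B' K) = Y m * Y' n * K`
  rcases eq_or_ne m 0 with rfl | hm
  · simp [ha]
  rcases eq_or_ne n 0 with rfl | hn
  · simp [hb]
  have hτm : ((((m.divisors.card : ℝ) ^ B' : ℝ) : ℂ)) ≠ 0 := by exact_mod_cast (hτpos m hm).ne'
  have hτn : ((((n.divisors.card : ℝ) ^ B' : ℝ) : ℂ)) ≠ 0 := by exact_mod_cast (hτpos n hn).ne'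
  simp only [ha, hb, hY, hY', if_neg hm, if_neg hn]
  field_simp

end Summit.Parity.GeneralizedHardyLittlewood.FordMaynardSieveConst01651SieveConst01651
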